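import Literature.AlgebraicGeometry.HodgeTheory.SimpleAbelianThreefoldCubicEndPowersHodgeClasses
import Literature.RingTheory.CentralSimple.DivisionAlgebraDimensionSixCommutative
import HarnessLib

/-!
# Hodge classes on all powers of a SIMPLE complex abelian threefold are generated by divisor classes
# (Tankeev–Ribet at the prime 3; Moonen–Zarhin 1999 §2 (2.3) with p. 715)

Family `hodge`, layer `Literature/AlgebraicGeometry/HodgeTheory`. Research context: cell `pub-hodge-ring2` (HONEST
FRAMING: research route conditional on HC_CM; not a corollary; Q11.4-sentence-2 already refuted in dim ≥ 3),
Literature lane, programme R13 «generic abelian threefolds», CONCLUSION. UNCONDITIONAL; theorems only, no definition,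
no named fact (D-0026), no `sorry`.

THE STATEMENT. For a SIMPLE complex abelian threefold `X`: `B•(X^{N+1}) = D•(X^{N+1}) ⊗ ℂ` for every `N`
(`AbelianVariety.isDivisorGenerated_powSucc_of_isSimple_of_dim_three`), the Hodge conjecture for all powers and
their isogeny classes, and the `p = 3` slice of the tree's named fact
`TankeevRibet1983_hodgeClasses_divisorial_powers_simplePrimeDimension` as a THEOREM (`tankeevRibet1983_of_dim_three`);
what remains of that fact is the non-CM case in prime dimension `≥ 5` (`tankeevRibet1983_iff_prime_ge_five_nonCM`).
PROOF. `dim_ℚ End⁰(X) ∈ {1,2,3,6}` (the case split `isDivisorGenerated_powSucc_of_isSimple_threefold` of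
`…CubicEnd…`, whose only hypothesis — commutativity of a six-dimensional `End⁰` — is discharged here by
`mul_comm_of_finrank_eq_six_of_isUnit_or_eq_zero`: a skew field has square dimension over its centre,
`DivisionRing.isSquare_finrank_center`, Wedderburn). MZ99 p. 715 [corpus: paper:arxiv-math_9901113 p0005 L19–L22]:
«For g := dim(X) ≤ 3 … we always find that Hg(X) = Sp_D(V,φ). Since type 3 does not occur … B(Xⁿ) = D(Xⁿ) for all n
… In particular the Hodge conjecture is true for all such Xⁿ».

## References

* [MoonenZarhin1999LowDim] B. Moonen, Yu. Zarhin, Math. Ann. 315 (1999), §2 (2.3), Thm. (2.7), p. 715.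
* [Tankeev1982] S. G. Tankeev, Cycles on simple abelian varieties of prime dimension, Izv. AN SSSR 46 (1982).
* [Ribet1983] K. Ribet, Hodge classes on certain types of abelian varieties, Amer. J. Math. 105 (1983).
* [SwinnertonDyer1974] H. P. F. Swinnerton-Dyer, Analytic Theory of Abelian Varieties (1974), §8 p. 63.
-/

noncomputable section

open CategoryTheory Module NumberField

namespace Literature.AlgebraicGeometry.HodgeTheory

open Literature.AlgebraicGeometry.Motives Literature.AlgebraicGeometry.ComplexMultiplication
open Literature.AlgebraicGeometry.Motives.HodgeStructure
open Literature.Barriers.HodgeConjecture (divisorClassesSpan)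
open Literature.RingTheory.CentralSimple (mul_comm_of_finrank_eq_six_of_isUnit_or_eq_zero)

section Main

variable {A : AbelianVariety ℂ}

/-- **A six-dimensional `End⁰` of a simple abelian variety is commutative** (a skew field of `ℚ`-dimension `6` is a
field: `[D:ℚ] = [Z:ℚ]·n²`, Wedderburn; Mumford §19 Cor. 2 for the division property).
[cite: SwinnertonDyer1974, §8 (p. 63)] [cite: MumfordAV1970, §19 Cor. 2 of Thm. 1 (p. 174)] -/
theorem AbelianVariety.mul_comm_endAlgebra_of_isSimple_of_finrank_eq_six (hA : A.IsSimple)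
    (h6 : Module.finrank ℚ A.endAlgebra = 6) (x y : A.endAlgebra) : x * y = y * x := by
  haveI : Module.Finite ℚ A.endAlgebra := AbelianVariety.finiteDimensional_endAlgebra_holds A
  exact mul_comm_of_finrank_eq_six_of_isUnit_or_eq_zero (isUnit_or_eq_zero_of_isSimple hA) h6 x y

/-- **Moonen–Zarhin 1999 (2.3) with p. 715, all powers — UNCONDITIONAL: `B•(A^{N+1}) = D•(A^{N+1}) ⊗ ℂ` for every
SIMPLE complex abelian threefold `A`** (types I(1): R13 `Hg = Sp₆`; IV(1,1)/I(2)-like quadratic `End⁰`: the tree;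
I(3): `…CubicEnd…`; IV(3,1): sextic CM field of degree `2 dim A`, `EndFieldFullDegree`; six-dimensional `End⁰`
is commutative by Wedderburn). [cite: MoonenZarhin1999LowDim, §2 (2.3) and p. 715] -/
theorem AbelianVariety.isDivisorGenerated_powSucc_of_isSimple_of_dim_three (A : AbelianVariety ℂ) (hA : A.IsSimple)
    (hdim : A.dim = 3) (N : ℕ) : IsDivisorGenerated (A.powSucc N) :=
  AbelianVariety.isDivisorGenerated_powSucc_of_isSimple_threefold A hA hdim
    (fun h6 => AbelianVariety.mul_comm_endAlgebra_of_isSimple_of_finrank_eq_six hA h6) N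

/-- `IsStablyNondegenerate A` (`B = D` on all powers) for every simple complex abelian threefold.
[cite: MoonenZarhin1999LowDim, §2 condition (D) and (2.3)] -/
theorem AbelianVariety.isStablyNondegenerate_of_isSimple_of_dim_three (A : AbelianVariety ℂ) (hA : A.IsSimple)
    (hdim : A.dim = 3) : IsStablyNondegenerate A :=
  fun N => AbelianVariety.isDivisorGenerated_powSucc_of_isSimple_of_dim_three A hA hdim N

/-- `A` itself: `B•(A) = D•(A) ⊗ ℂ` for a simple abelian threefold. [cite: MoonenZarhin1999LowDim, §2 (2.3)] -/
theorem AbelianVariety.isDivisorGenerated_of_isSimple_of_dim_three (A : AbelianVariety ℂ) (hA : A.IsSimple)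
    (hdim : A.dim = 3) : IsDivisorGenerated A :=
  (AbelianVariety.isStablyNondegenerate_of_isSimple_of_dim_three A hA hdim).isDivisorGenerated

/-- **The Hodge conjecture for every power `A^{N+1}` of a simple complex abelian threefold — UNCONDITIONAL.** MZ99
p. 715: «In particular the Hodge conjecture is true for all such Xⁿ». [cite: MoonenZarhin1999LowDim, §2 p. 715 and (2.3)] -/
theorem hodgeConjectureFor_powSucc_of_isSimple_of_dim_three (A : AbelianVariety ℂ) (hA : A.IsSimple)
    (hdim : A.dim = 3) (N : ℕ) : HodgeConjectureFor (A.powSucc N).dim (A.powSucc N).X :=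
  hodgeConjectureFor_of_isDivisorGenerated _
    (AbelianVariety.isDivisorGenerated_powSucc_of_isSimple_of_dim_three A hA hdim N)

/-- The Hodge conjecture for a simple abelian threefold itself. [cite: MoonenZarhin1999LowDim, §2 (2.3)] -/
theorem hodgeConjectureFor_of_isSimple_of_dim_three (A : AbelianVariety ℂ) (hA : A.IsSimple) (hdim : A.dim = 3) :
    HodgeConjectureFor A.dim A.X :=
  hodgeConjectureFor_of_isDivisorGenerated _ (AbelianVariety.isDivisorGenerated_of_isSimple_of_dim_three A hA hdim)

/-- **The Hodge conjecture for every complex abelian variety isogenous to a power of a simple abelian threefold.**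
[cite: MoonenZarhin1999LowDim, §2 (2.3)] [cite: vanGeemen1994HodgeAV, Lemma 3.7] -/
theorem hodgeConjectureFor_of_isIsogenous_powSucc_of_isSimple_of_dim_three {A B : AbelianVariety ℂ}
    (hA : A.IsSimple) (hdim : A.dim = 3) {N : ℕ} (hB : B.IsIsogenous (A.powSucc N)) :
    HodgeConjectureFor B.dim B.X :=
  HodgeConjectureFor.of_isIsogenous hB (hodgeConjectureFor_powSucc_of_isSimple_of_dim_three A hA hdim N)

/-- `B = D` for every complex abelian variety isogenous to a power of a simple abelian threefold.
[cite: MoonenZarhin1999LowDim, §2 (2.3)] -/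
theorem isDivisorGenerated_of_isIsogenous_powSucc_of_isSimple_of_dim_three {A B : AbelianVariety ℂ}
    (hA : A.IsSimple) (hdim : A.dim = 3) {N : ℕ} (hB : B.IsIsogenous (A.powSucc N)) : IsDivisorGenerated B :=
  (AbelianVariety.isDivisorGenerated_powSucc_of_isSimple_of_dim_three A hA hdim N).of_isIsogenous hB

/-- The cycle part in the fact's consequence shape: every rational `(m,m)`-class on every power of a simple abelian
threefold is algebraic. [cite: MoonenZarhin1999LowDim, §2 Thm. (2.7) and (2.3)] -/
theorem hodgeClasses_algebraic_powSucc_of_isSimple_of_dim_three (A : AbelianVariety ℂ) (hA : A.IsSimple)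
    (hdim : A.dim = 3) (N m : ℕ) (c : complexBetti (A.powSucc N).X (2 * m)) (hc : IsRationalClass c)
    (hmm : IsOfHodgeType (A.powSucc N).dim (A.powSucc N).X (2 * m) m m c) :
    c ∈ algebraicClasses (A.powSucc N).X m :=
  (hodgeConjectureFor_powSucc_of_isSimple_of_dim_three A hA hdim N).2 m c hc hmm

/-- **The `p = 3` slice of the tree's named fact `TankeevRibet1983_hodgeClasses_divisorial_powers_simplePrimeDimension`,
as a THEOREM**: for a SIMPLE complex abelian variety `X` of dimension `3`, every rational `(m,m)`-class on every power
`X^{N+1}` lies in `Dᵐ(X^{N+1}) ⊗ ℂ`. [cite: MoonenZarhin1999LowDim, §2 Thm. (2.7) and (2.3)]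
[cite: Gordon1999HodgeAVSurvey, Thm. 6.3 and Corollary] -/
theorem tankeevRibet1983_of_dim_three :
    ∀ (X : AbelianVariety ℂ), X.dim = 3 → X.IsSimple →
      ∀ (N m : ℕ) (c : complexBetti (X.powSucc N).X (2 * m)), IsRationalClass c →
        IsOfHodgeType (X.powSucc N).dim (X.powSucc N).X (2 * m) m m c →
          c ∈ divisorClassesSpan (X.powSucc N).X (X.powSucc N).dim m :=
  fun X hX hs N m c hc hmm => AbelianVariety.isDivisorGenerated_powSucc_of_isSimple_of_dim_three X hs hX N m c hc hmm

/-- **What remains of the Tankeev–Ribet fact after this file: simple, NON-CM, of prime dimension `p ≥ 5`.**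
(`p = 2`: `tankeevRibet1983_of_dim_two`; `p = 3`: `tankeevRibet1983_of_dim_three`; CM: Pohlmann.)
[cite: MoonenZarhin1999LowDim, §2 Thm. (2.7)] [cite: Gordon1999HodgeAVSurvey, Thm. 6.3 and Corollary] -/
theorem tankeevRibet1983_iff_prime_ge_five_nonCM :
    TankeevRibet1983_hodgeClasses_divisorial_powers_simplePrimeDimension ↔
      ∀ (X : AbelianVariety ℂ) (p : ℕ), p.Prime → 5 ≤ p → X.dim = p → X.IsSimple →
        ¬ Literature.AlgebraicGeometry.Milne1999.IsOfCMType X →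
        ∀ (N m : ℕ) (c : complexBetti (X.powSucc N).X (2 * m)), IsRationalClass c →
          IsOfHodgeType (X.powSucc N).dim (X.powSucc N).X (2 * m) m m c →
            c ∈ divisorClassesSpan (X.powSucc N).X (X.powSucc N).dim m := by
  rw [tankeevRibet1983_iff_odd_prime_nonCM]
  refine ⟨fun h X p hp h5 hX hs hcm => h X p hp (by omega) hX hs hcm, fun h X p hp hp2 hX hs hcm N m c hc hmm => ?_⟩
  by_cases hp3 : p = 3
  · subst hp3
    exact tankeevRibet1983_of_dim_three X hX hs N m c hc hmm
  · have h5 : 5 ≤ p := by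
      rcases Nat.lt_or_ge p 5 with hlt | hge
      · interval_cases p <;> first | exact absurd hp (by decide) | omega
      · exact hge
    exact h X p hp h5 hX hs hcm N m c hc hmm

end Main

end Literature.AlgebraicGeometry.HodgeTheory

end
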